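import Summits.CriticalPhenomena.PercolationContinuityZ3.Theorems.Transplant.PathMapDomination
import Summits.CriticalPhenomena.PercolationContinuityZ3.Theorems.Transplant.CayleyZSqCriticalProbLtOne
import Literature.Barriers.CriticalPhenomena.SubexponentialGrowthZdProofs
import HarnessLib

/-!
# Customers of the path-map domination principle: `p_c < 1` ASCENDS from every finitely generated subgroup (every injective homomorphism) and is
# INDEPENDENT OF THE GENERATING SET (Lyons–Peres Thm. 7.15 verbatim); the bounded-degree rough-embedding form

builds on p205010 (kernel theorem, internal audit signed; external expert review pending) — nothing in this file uses p205010; unconditional, no node.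
Lane `prim-bschramm`, seat `prim-bschramm-p4` gen 24 (PART C3 of `P4-GENERAL.md` §46).  Helper file (`--supports stmt-CriticalPhenomena-4575 --as helper`).

THE POINT.  With `PathMapDom.criticalProb_lt_one` (any source graph) the hypothesis side of Benjamini–Schramm's Conjecture 4 becomes STRUCTURAL:
* **`CayleyPathMap.criticalProb_lt_one_of_injective_hom`** — an injective homomorphism `φ : A →* Γ` and ANY finite `T ⊆ A` with
  `p_c(Cay(A;T), a₀) < 1` force `p_c(Cay(Γ;S), g) < 1` for EVERY finite generating `S` of `Γ` and every vertex `g` (path map `a ↦ g·φ(a₀)⁻¹·φ(a)`,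
  an edge `a ∼ a t` goes to the `S`-word path of `φ t`; multiplicity `≤ 4|T∪T⁻¹|(L+1)`).  So `p_c < 1` ASCENDS from every finitely generated subgroup
  (`criticalProb_lt_one_of_subgroup`) — the common generalisation of the tree's certificates `ℤ² ≤ Γ` (gen 22), products `A × B ≤ Γ` (gen 23),
  free pairs, central rays: ANY subgroup with ANY certificate will do, and no commutation is needed;
* **`criticalProb_lt_one_iff_of_generating`** — for two finite generating sets `S₁, S₂` of `Γ`: `p_c(Cay(Γ;S₁), g) < 1 ⟺ p_c(Cay(Γ;S₂), g) < 1`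
  (Lyons–Peres Thm. 7.15 VERBATIM; the tree had only monotonicity in `S`, `CayleyZSq.criticalProb_anti_gens`);
* **`GraphPathMap.criticalProb_lt_one_of_lipschitz`** — the remark after Thm. 7.15 for graphs: `f : U → W` sending adjacent vertices of `H` to
  vertices at distance `≤ L` in `G`, fibres of size `≤ K`, degrees of `H` `≤ D_H` and of `G` `≤ D_G`; then `p_c(H, x) < 1 ⟹ p_c(G, f x) < 1`.
[cite: LyonsPeres2016, §7.4 Thm. 7.15 and the remark following it; Prop. 7.14] [cite: BenjaminiSchramm1996, §2 Conj. 1 (Cayley graphs); Conj. 4]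
-/

noncomputable section

namespace Summit.CriticalPhenomena.PercolationContinuityZ3.Theorems.Transplant

open SimpleGraph Literature.Probability.Percolation Literature.Probability.LatticeModels Literature.Barriers.CriticalPhenomena
open scoped Classical

/-! ## §1 Cayley graphs: injective homomorphisms, subgroups, generating sets -/

namespace CayleyPathMap

variable {A Γ : Type} [Group A] [Group Γ]

/-- A chosen `S`-word for every element of `Γ = ⟨S⟩` (letters in `S ∪ S⁻¹`, none trivial). [folklore] -/
theorem exists_wordFun (S : Finset Γ) (hS : Subgroup.closure (S : Set Γ) = ⊤) :
    ∃ wd : Γ → List Γ, ∀ x, (∀ y ∈ wd x, y ≠ 1 ∧ (y ∈ S ∨ y⁻¹ ∈ S)) ∧ (wd x).prod = x := by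
  choose wd hwd using CayleyZSq.exists_word S hS
  exact ⟨wd, hwd⟩

/-- The (oriented) path of the target over the source edge `u → v`: the `S`-word path of `φ(u⁻¹ v)` read from `f u`, where
`f a = g₀ · φ a`; empty unless `u ∼ v` in `Cay(A;T)`. [cite: LyonsPeres2016, §7.4 proof of Thm. 7.15 ("the path from x to xs determined by φ(s)")] -/
def opath (T : Finset A) (φ : A →* Γ) (g₀ : Γ) (wd : Γ → List Γ) (u v : A) : Finset (Sym2 Γ) :=
  if (mulCayley (↑T : Set A)).Adj u v then
    (Finset.range (wd (φ (u⁻¹ * v))).length).image fun i =>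
      s(g₀ * φ u * ((wd (φ (u⁻¹ * v))).take i).prod, g₀ * φ u * ((wd (φ (u⁻¹ * v))).take (i + 1)).prod)
  else ∅

/-- The symmetric path datum on unordered source edges: both oriented paths. [folklore] -/
def spath (T : Finset A) (φ : A →* Γ) (g₀ : Γ) (wd : Γ → List Γ) : Sym2 A → Finset (Sym2 Γ) :=
  Sym2.lift ⟨fun u v => opath T φ g₀ wd u v ∪ opath T φ g₀ wd v u, fun _ _ => Finset.union_comm _ _⟩

/-- `spath` on a pair. [folklore] -/
theorem spath_mk (T : Finset A) (φ : A →* Γ) (g₀ : Γ) (wd : Γ → List Γ) (u v : A) :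
    spath T φ g₀ wd s(u, v) = opath T φ g₀ wd u v ∪ opath T φ g₀ wd v u := rfl

variable {S : Finset Γ} {T : Finset A} {φ : A →* Γ} {g₀ : Γ} {wd : Γ → List Γ}

/-- Properties of an oriented path over an edge `u ∼ v`: size, edges of `Cay(Γ;S)`, it joins `g₀ φ u` to `g₀ φ v`, and every edge on it has
an endpoint `g₀ φ(u) · (prefix product)`. [folklore] -/
theorem opath_spec (hwd : ∀ x, (∀ y ∈ wd x, y ≠ 1 ∧ (y ∈ S ∨ y⁻¹ ∈ S)) ∧ (wd x).prod = x) {u v : A}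
    (huv : (mulCayley (↑T : Set A)).Adj u v) :
    (opath T φ g₀ wd u v).card ≤ (wd (φ (u⁻¹ * v))).length ∧
    (↑(opath T φ g₀ wd u v) : Set (Sym2 Γ)) ⊆ (mulCayley (↑S : Set Γ)).edgeSet ∧
    (∀ ω : BondConfig Γ, (↑(opath T φ g₀ wd u v) : Set (Sym2 Γ)) ⊆ ω → (openGraph ω).Reachable (g₀ * φ u) (g₀ * φ v)) ∧
    ∀ e ∈ opath T φ g₀ wd u v, ∃ i ≤ (wd (φ (u⁻¹ * v))).length, g₀ * φ u * ((wd (φ (u⁻¹ * v))).take i).prod ∈ e := by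
  obtain ⟨hl, hprod⟩ := hwd (φ (u⁻¹ * v))
  obtain ⟨hcard, hE, hreach, hend⟩ := CayleyZSq.pathEdges_spec S (g₀ * φ u) (wd (φ (u⁻¹ * v))) hl
  have hop : opath T φ g₀ wd u v = (Finset.range (wd (φ (u⁻¹ * v))).length).image fun i =>
      s(g₀ * φ u * ((wd (φ (u⁻¹ * v))).take i).prod, g₀ * φ u * ((wd (φ (u⁻¹ * v))).take (i + 1)).prod) := by
    rw [opath, if_pos huv]
  rw [hop]
  refine ⟨hcard, hE, fun ω hω => ?_, hend⟩
  have htarget : g₀ * φ u * (wd (φ (u⁻¹ * v))).prod = g₀ * φ v := by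
    rw [hprod, map_mul, map_inv, mul_assoc, mul_inv_cancel_left]
  rw [← htarget]
  exact hreach.mono (openGraph_mono hω)

/-- The oriented path over a NON-edge is empty. [folklore] -/
theorem opath_of_not_adj {u v : A} (huv : ¬ (mulCayley (↑T : Set A)).Adj u v) : opath T φ g₀ wd u v = ∅ := by
  rw [opath, if_neg huv]

/-- **`p_c < 1` ASCENDS ALONG INJECTIVE HOMOMORPHISMS, for every generating set**: `φ : A →* Γ` injective, `T ⊆ A` finite with
`p_c(Cay(A;T), a₀) < 1`, `S` a finite generating set of `Γ` ⟹ `p_c(Cay(Γ;S), g) < 1` at every `g`.  (Path map `a ↦ g φ(a₀)⁻¹ φ(a)`; Lyons–Peres'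
domination principle with ANY source graph, `PathMapDom.criticalProb_lt_one`.)
[cite: LyonsPeres2016, §7.4 Thm. 7.15 and the remark following it] [cite: BenjaminiSchramm1996, §2 (Cayley graphs)] -/
theorem criticalProb_lt_one_of_injective_hom (S : Finset Γ) (hS : Subgroup.closure (S : Set Γ) = ⊤) (φ : A →* Γ)
    (hφ : Function.Injective φ) (T : Finset A) (a₀ : A) (hpc : criticalProb (mulCayley (↑T : Set A)) a₀ < 1) (g : Γ) :
    criticalProb (mulCayley (↑S : Set Γ)) g < 1 := by
  obtain ⟨wd, hwd⟩ := exists_wordFun S hS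
  haveI : Countable A := by
    haveI : Countable Γ := countable_of_connected_of_locallyFinite _ (CayleyScaled.connected_mulCayley_of_closure S hS) 1
    exact Function.Injective.countable hφ
  set g₀ : Γ := g * (φ a₀)⁻¹ with hg₀
  set f : A → Γ := fun a => g₀ * φ a with hf
  -- the letters of `T ∪ T⁻¹` and the length bound
  set Tpm : Finset A := T ∪ T.image (·⁻¹) with hTpm
  set L : ℕ := Tpm.sup fun t => (wd (φ t)).length with hL
  have hadjT : ∀ {u v : A}, (mulCayley (↑T : Set A)).Adj u v → u⁻¹ * v ∈ Tpm := fun {u v} huv => by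
    rcases ((mulCayley_adj _ u v).1 huv).2 with h | h
    · exact Finset.mem_union_left _ (Finset.mem_coe.1 h)
    · refine Finset.mem_union_right _ (Finset.mem_image.2 ⟨v⁻¹ * u, Finset.mem_coe.1 h, by rw [mul_inv_rev, inv_inv]⟩)
  have hlen : ∀ {u v : A}, (mulCayley (↑T : Set A)).Adj u v → (wd (φ (u⁻¹ * v))).length ≤ L := fun huv =>
    Finset.le_sup (f := fun t => (wd (φ t)).length) (hadjT huv)
  set P : Sym2 A → Finset (Sym2 Γ) := spath T φ g₀ wd with hP
  -- (1) paths realise edges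
  have hconn : ∀ x y, (mulCayley (↑T : Set A)).Adj x y → ∀ ω : BondConfig Γ, (↑(P s(x, y)) : Set (Sym2 Γ)) ⊆ ω →
      (openGraph ω).Reachable (f x) (f y) := fun x y hxy ω hω => by
    rw [hP, spath_mk, Finset.coe_union] at hω
    exact (opath_spec hwd hxy).2.2.1 ω (Set.union_subset_iff.1 hω).1
  -- (2) paths lie in `E(Cay(Γ;S))`
  have hPE : ∀ e ∈ (mulCayley (↑T : Set A)).edgeSet, (↑(P e) : Set (Sym2 Γ)) ⊆ (mulCayley (↑S : Set Γ)).edgeSet := by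
    intro e he
    induction e using Sym2.ind with
    | _ u v =>
      have huv := (mem_edgeSet _).1 he
      rw [hP, spath_mk, Finset.coe_union]
      exact Set.union_subset (opath_spec hwd huv).2.1 (opath_spec hwd huv.symm).2.1
  -- (3) path lengths `≤ 2L`
  have hPn : ∀ e ∈ (mulCayley (↑T : Set A)).edgeSet, (P e).card ≤ 2 * L + 1 := by
    intro e he
    induction e using Sym2.ind with
    | _ u v =>
      have huv := (mem_edgeSet _).1 he
      rw [hP, spath_mk]
      calc (opath T φ g₀ wd u v ∪ opath T φ g₀ wd v u).card
          ≤ (opath T φ g₀ wd u v).card + (opath T φ g₀ wd v u).card := Finset.card_union_le _ _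
        _ ≤ L + L := Nat.add_le_add ((opath_spec hwd huv).1.trans (hlen huv)) ((opath_spec hwd huv.symm).1.trans (hlen huv.symm))
        _ ≤ 2 * L + 1 := by omega
  -- (4) fibres of `f` are subsingletons
  have hfinj : Function.Injective f := fun a b h => hφ (mul_left_cancel h)
  have hfib : ∀ w, (f ⁻¹' {w}).Finite := fun w =>
    Set.Finite.subset (Set.finite_empty.insert (Function.invFun f w)) fun a ha => by
      left
      have : f a = w := ha
      rw [← this, Function.leftInverse_invFun hfinj a]
  -- (5) multiplicity: the source edges over a target edge `a` are among `s(ψ, ψ t)`, `ψ = φ⁻¹(g₀⁻¹ z p⁻¹)`, `z ∈ a`, `t ∈ T ∪ T⁻¹`, `p` a prefix product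
  haveI : Nonempty A := ⟨a₀⟩
  set m : ℕ := 2 * Tpm.card * (L + 1) + 1 with hm
  have hover : ∀ a : Sym2 Γ, (PathMapDom.over (mulCayley (↑T : Set A)) P a).Finite ∧ (PathMapDom.over (mulCayley (↑T : Set A)) P a).ncard ≤ m := by
    intro a
    induction a using Sym2.ind with
    | _ z₁ z₂ =>
      set ψ : Γ × A × ℕ → A := fun q => Function.invFun φ (g₀⁻¹ * q.1 * (((wd (φ q.2.1)).take q.2.2).prod)⁻¹) with hψ
      set F : Finset (Sym2 A) := ((({z₁, z₂} : Finset Γ) ×ˢ Tpm) ×ˢ Finset.range (L + 1)).image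
        fun q => s(ψ (q.1.1, q.1.2, q.2), ψ (q.1.1, q.1.2, q.2) * q.1.2) with hF
      -- every source edge over `s(z₁, z₂)` lies in `F`
      have hsub : PathMapDom.over (mulCayley (↑T : Set A)) P s(z₁, z₂) ⊆ ↑F := by
        intro e he
        obtain ⟨heE, hae⟩ := he
        induction e using Sym2.ind with
        | _ u v =>
          have huv := (mem_edgeSet _).1 heE
          -- the oriented case, for either orientation
          have key : ∀ {u v : A}, (mulCayley (↑T : Set A)).Adj u v → s(z₁, z₂) ∈ opath T φ g₀ wd u v → s(u, v) ∈ F := by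
            intro u v huv hmem
            obtain ⟨i, hi, hzi⟩ := (opath_spec hwd huv).2.2.2 _ hmem
            set t : A := u⁻¹ * v with ht
            set z : Γ := g₀ * φ u * ((wd (φ t)).take i).prod with hz
            have hzmem : z ∈ ({z₁, z₂} : Finset Γ) := by
              rcases Sym2.mem_iff.1 hzi with h | h
              · rw [h]; exact Finset.mem_insert_self _ _
              · rw [h]; exact Finset.mem_insert_of_mem (Finset.mem_singleton_self _)
            have hψu : ψ (z, t, i) = u := by
              have hφu : g₀⁻¹ * z * (((wd (φ t)).take i).prod)⁻¹ = φ u := by rw [hz]; group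
              show Function.invFun φ (g₀⁻¹ * z * (((wd (φ t)).take i).prod)⁻¹) = u
              rw [hφu, Function.leftInverse_invFun hφ u]
            refine Finset.mem_image.2 ⟨((z, t), i), Finset.mem_product.2 ⟨Finset.mem_product.2 ⟨hzmem, hadjT huv⟩,
              Finset.mem_range.2 (Nat.lt_succ_of_le (hi.trans (hlen huv)))⟩, ?_⟩
            show s(ψ (z, t, i), ψ (z, t, i) * t) = s(u, v)
            rw [hψu, ht, mul_inv_cancel_left]
          rw [hP, spath_mk, Finset.mem_union] at hae
          rcases hae with h | h
          · exact key huv h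
          · rw [Sym2.eq_swap]; exact key huv.symm h
      refine ⟨F.finite_toSet.subset hsub, ?_⟩
      calc (PathMapDom.over (mulCayley (↑T : Set A)) P s(z₁, z₂)).ncard ≤ (↑F : Set (Sym2 A)).ncard := Set.ncard_le_ncard hsub F.finite_toSet
        _ = F.card := Set.ncard_coe_finset F
        _ ≤ ((({z₁, z₂} : Finset Γ) ×ˢ Tpm) ×ˢ Finset.range (L + 1)).card := Finset.card_image_le
        _ ≤ m := by
          rw [Finset.card_product, Finset.card_product, Finset.card_range, hm]
          have h2 : ({z₁, z₂} : Finset Γ).card ≤ 2 := Finset.card_le_two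
          nlinarith [h2, Nat.zero_le Tpm.card]
  obtain ⟨slot, hslot⟩ := PathMapDom.exists_slot (H := mulCayley (↑T : Set A)) (P := P) (m := m) (by rw [hm]; omega) hover
  have h := PathMapDom.criticalProb_lt_one (G := mulCayley (↑S : Set Γ)) (n := 2 * L + 1) (slot := slot) (by omega) hslot hconn hPE hPn
    hfib a₀ hpc
  have hfa : f a₀ = g := by show g * (φ a₀)⁻¹ * φ a₀ = g; rw [inv_mul_cancel_right]
  rwa [hfa] at h

/-- **`p_c < 1` ASCENDS FROM SUBGROUPS, for every generating set**: a subgroup `H ≤ Γ` with a finite `T ⊆ H` such that `p_c(Cay(H;T), h₀) < 1`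
forces `p_c(Cay(Γ;S), g) < 1` for EVERY finite generating `S` of `Γ`. [cite: LyonsPeres2016, §7.4 Thm. 7.15 and the remark following it]
[cite: BenjaminiSchramm1996, §2 (Cayley graphs)] -/
theorem criticalProb_lt_one_of_subgroup (S : Finset Γ) (hS : Subgroup.closure (S : Set Γ) = ⊤) (H : Subgroup Γ) (T : Finset H) (h₀ : H)
    (hpc : criticalProb (mulCayley (↑T : Set H)) h₀ < 1) (g : Γ) : criticalProb (mulCayley (↑S : Set Γ)) g < 1 :=
  criticalProb_lt_one_of_injective_hom S hS H.subtype H.subtype_injective T h₀ hpc g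

/-- **Monotonicity in the OPPOSITE direction to inclusion**: for ANY finite `T ⊆ Γ` (generating or not) and any finite generating `S`,
`p_c(Cay(Γ;T), g₀) < 1 ⟹ p_c(Cay(Γ;S), g) < 1`. [cite: LyonsPeres2016, §7.4 Thm. 7.15] -/
theorem criticalProb_lt_one_of_finset (S : Finset Γ) (hS : Subgroup.closure (S : Set Γ) = ⊤) (T : Finset Γ) (g₀ : Γ)
    (hpc : criticalProb (mulCayley (↑T : Set Γ)) g₀ < 1) (g : Γ) : criticalProb (mulCayley (↑S : Set Γ)) g < 1 :=
  criticalProb_lt_one_of_injective_hom S hS (MonoidHom.id Γ) (fun _ _ h => h) T g₀ hpc g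

/-- **LYONS–PERES THM. 7.15 (verbatim): `p_c < 1` does not depend on the finite generating set.**  For finite generating sets `S₁, S₂` of `Γ`
and vertices `g₁, g₂`: `p_c(Cay(Γ;S₁), g₁) < 1 ⟺ p_c(Cay(Γ;S₂), g₂) < 1`. [cite: LyonsPeres2016, §7.4 Thm. 7.15] -/
theorem criticalProb_lt_one_iff_of_generating (S₁ S₂ : Finset Γ) (h₁ : Subgroup.closure (S₁ : Set Γ) = ⊤)
    (h₂ : Subgroup.closure (S₂ : Set Γ) = ⊤) (g₁ g₂ : Γ) :
    criticalProb (mulCayley (↑S₁ : Set Γ)) g₁ < 1 ↔ criticalProb (mulCayley (↑S₂ : Set Γ)) g₂ < 1 :=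
  ⟨fun h => criticalProb_lt_one_of_finset S₂ h₂ S₁ g₁ h g₂, fun h => criticalProb_lt_one_of_finset S₁ h₁ S₂ g₂ h g₁⟩

end CayleyPathMap

/-! ## §2 Graphs: the bounded-degree rough-embedding form (the remark after Thm. 7.15) -/

namespace GraphPathMap

variable {U W : Type} {H : SimpleGraph U} {G : SimpleGraph W}

/-- **The edge set of a walk** (consecutive `getVert` pairs): at most `length` edges, all in `E(G)`, joining the endpoints as an open subgraph, every
edge containing some `getVert i`, `i ≤ length`. [folklore] -/
theorem walkEdges_spec {a b : W} (wk : G.Walk a b) :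
    ((Finset.range wk.length).image fun i => s(wk.getVert i, wk.getVert (i + 1))).card ≤ wk.length ∧
    (↑((Finset.range wk.length).image fun i => s(wk.getVert i, wk.getVert (i + 1))) : Set (Sym2 W)) ⊆ G.edgeSet ∧
    (∀ ω : BondConfig W, (↑((Finset.range wk.length).image fun i => s(wk.getVert i, wk.getVert (i + 1))) : Set (Sym2 W)) ⊆ ω →
      (openGraph ω).Reachable a b) ∧
    ∀ e ∈ ((Finset.range wk.length).image fun i => s(wk.getVert i, wk.getVert (i + 1))), ∃ i ≤ wk.length, wk.getVert i ∈ e := by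
  set E : Finset (Sym2 W) := (Finset.range wk.length).image fun i => s(wk.getVert i, wk.getVert (i + 1)) with hE
  have hadj : ∀ i, i < wk.length → G.Adj (wk.getVert i) (wk.getVert (i + 1)) := fun i hi => wk.adj_getVert_succ hi
  refine ⟨Finset.card_image_le.trans (Finset.card_range _).le, fun e he => ?_, fun ω hω => ?_, fun e he => ?_⟩
  · obtain ⟨i, hi, rfl⟩ := Finset.mem_image.1 (Finset.mem_coe.1 he)
    exact (mem_edgeSet _).2 (hadj i (Finset.mem_range.1 hi))
  · have key : ∀ i, i ≤ wk.length → (openGraph ω).Reachable a (wk.getVert i) := by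
      intro i
      induction i with
      | zero => intro _; rw [Walk.getVert_zero]
      | succ i ih =>
        intro hi
        have hi' : i < wk.length := hi
        refine (ih hi'.le).trans (Adj.reachable ?_)
        rw [openGraph_adj]
        exact ⟨hω (Finset.mem_coe.2 (Finset.mem_image.2 ⟨i, Finset.mem_range.2 hi', rfl⟩)), (hadj i hi').ne⟩
    have h := key wk.length le_rfl
    rwa [Walk.getVert_length] at h
  · obtain ⟨i, hi, rfl⟩ := Finset.mem_image.1 he
    exact ⟨i, (Finset.mem_range.1 hi).le, Sym2.mem_mk_left _ _⟩

/-- A point of a walk of length `≤ L` from `a` lies in the ball `B(·, L)` around it containing `a`: `a ∈ B(getVert i, L)`. [folklore] -/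
theorem start_mem_graphBall_getVert {a b : W} (wk : G.Walk a b) {L : ℕ} (hL : wk.length ≤ L) (i : ℕ) : a ∈ graphBall G (wk.getVert i) L :=
  ⟨(wk.take i).reverse, by rw [Walk.length_reverse, Walk.take_length]; exact (min_le_right _ _).trans hL⟩

/-- **THE ROUGH-EMBEDDING FORM (graphs of bounded degree)**: `f : U → W` sends adjacent vertices of `H` to vertices joined in `G` by a walk of length
`≤ L`, has fibres of size `≤ K`; degrees of `H` are `≤ D_H`, of `G` `≤ D_G`.  Then `p_c(H, x) < 1 ⟹ p_c(G, f x) < 1`.  (The remark after Lyons–Peres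
Thm. 7.15: "the preceding proof extends … to two graphs that are roughly isometric and have bounded degrees" — a rough isometry restricted to vertices is
such an `f`; multiplicity `≤ 2(D_G+1)^L K D_H + 1`.) [cite: LyonsPeres2016, §7.4 Thm. 7.15 and the remark following it] -/
theorem criticalProb_lt_one_of_lipschitz [Countable U] [H.LocallyFinite] [G.LocallyFinite] (f : U → W) {L K DH DG : ℕ}
    (hL : ∀ x y, H.Adj x y → ∃ wk : G.Walk (f x) (f y), wk.length ≤ L) (hK : ∀ w, (f ⁻¹' {w}).Finite ∧ (f ⁻¹' {w}).ncard ≤ K)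
    (hDH : ∀ u, H.degree u ≤ DH) (hDG : ∀ w, G.degree w ≤ DG) (x : U) (hpc : criticalProb H x < 1) : criticalProb G (f x) < 1 := by
  -- the chosen walk over an oriented edge and its edge set (empty over non-edges)
  set wk : ∀ x y, H.Adj x y → G.Walk (f x) (f y) := fun x y h => Classical.choose (hL x y h) with hwk
  have hwkL : ∀ x y (h : H.Adj x y), (wk x y h).length ≤ L := fun x y h => Classical.choose_spec (hL x y h)
  set Q : U → U → Finset (Sym2 W) := fun x y =>
    if h : H.Adj x y then (Finset.range (wk x y h).length).image fun i => s((wk x y h).getVert i, (wk x y h).getVert (i + 1)) else ∅ with hQ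
  have hQpos : ∀ {x y} (h : H.Adj x y),
      Q x y = (Finset.range (wk x y h).length).image fun i => s((wk x y h).getVert i, (wk x y h).getVert (i + 1)) := fun h => by
    simp only [hQ, dif_pos h]
  set P : Sym2 U → Finset (Sym2 W) := Sym2.lift ⟨fun x y => Q x y ∪ Q y x, fun _ _ => Finset.union_comm _ _⟩ with hP
  have hPmk : ∀ x y, P s(x, y) = Q x y ∪ Q y x := fun x y => rfl
  -- (1) paths realise edges
  have hconn : ∀ x y, H.Adj x y → ∀ ω : BondConfig W, (↑(P s(x, y)) : Set (Sym2 W)) ⊆ ω → (openGraph ω).Reachable (f x) (f y) := by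
    intro x y hxy ω hω
    rw [hPmk, Finset.coe_union, Set.union_subset_iff, hQpos hxy] at hω
    exact (walkEdges_spec (wk x y hxy)).2.2.1 ω hω.1
  -- (2) paths lie in `E(G)`
  have hPE : ∀ e ∈ H.edgeSet, (↑(P e) : Set (Sym2 W)) ⊆ G.edgeSet := by
    intro e he
    induction e using Sym2.ind with
    | _ x y =>
      have hxy := (mem_edgeSet _).1 he
      rw [hPmk, Finset.coe_union, hQpos hxy, hQpos hxy.symm]
      exact Set.union_subset (walkEdges_spec (wk x y hxy)).2.1 (walkEdges_spec (wk y x hxy.symm)).2.1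
  -- (3) path sizes `≤ 2L + 1`
  have hPn : ∀ e ∈ H.edgeSet, (P e).card ≤ 2 * L + 1 := by
    intro e he
    induction e using Sym2.ind with
    | _ x y =>
      have hxy := (mem_edgeSet _).1 he
      rw [hPmk]
      calc (Q x y ∪ Q y x).card ≤ (Q x y).card + (Q y x).card := Finset.card_union_le _ _
        _ ≤ L + L := by
            rw [hQpos hxy, hQpos hxy.symm]
            exact Nat.add_le_add ((walkEdges_spec (wk x y hxy)).1.trans (hwkL x y hxy))
              ((walkEdges_spec (wk y x hxy.symm)).1.trans (hwkL y x hxy.symm))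
        _ ≤ 2 * L + 1 := by omega
  -- (4) multiplicity: a source edge over the target edge `s(z₁, z₂)` is `s(x', y')` with `f x' ∈ B(zᵢ, L)` and `y' ∼ x'`
  set m : ℕ := 2 * (DG + 1) ^ L * K * DH + 1 with hm
  have hover : ∀ a : Sym2 W, (PathMapDom.over H P a).Finite ∧ (PathMapDom.over H P a).ncard ≤ m := by
    intro a
    induction a using Sym2.ind with
    | _ z₁ z₂ =>
      set F : Finset (Sym2 U) := (({z₁, z₂} : Finset W).biUnion fun z => (graphBall_finite G z L).toFinset).biUnion fun w =>
        ((hK w).1.toFinset).biUnion fun x' => (H.neighborFinset x').image fun y' => s(x', y') with hF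
      have key : ∀ {x' y' : U} (h : H.Adj x' y'), s(z₁, z₂) ∈ Q x' y' → s(x', y') ∈ F := by
        intro x' y' h hmem
        rw [hQpos h] at hmem
        obtain ⟨i, hi, hzi⟩ := (walkEdges_spec (wk x' y' h)).2.2.2 _ hmem
        have hball : f x' ∈ graphBall G ((wk x' y' h).getVert i) L := start_mem_graphBall_getVert (wk x' y' h) (hwkL x' y' h) i
        refine Finset.mem_biUnion.2 ⟨f x', Finset.mem_biUnion.2 ⟨(wk x' y' h).getVert i, ?_, (Set.Finite.mem_toFinset _).2 hball⟩,
          Finset.mem_biUnion.2 ⟨x', (Set.Finite.mem_toFinset _).2 rfl, Finset.mem_image.2 ⟨y', (mem_neighborFinset _ _ _).2 h, rfl⟩⟩⟩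
        rcases Sym2.mem_iff.1 hzi with h' | h'
        · rw [h']; exact Finset.mem_insert_self _ _
        · rw [h']; exact Finset.mem_insert_of_mem (Finset.mem_singleton_self _)
      have hsub : PathMapDom.over H P s(z₁, z₂) ⊆ ↑F := by
        intro e he
        obtain ⟨heE, hae⟩ := he
        induction e using Sym2.ind with
        | _ x' y' =>
          have hxy := (mem_edgeSet _).1 heE
          rw [hPmk, Finset.mem_union] at hae
          rcases hae with h | h
          · exact key hxy h
          · rw [Sym2.eq_swap]; exact key hxy.symm h
      refine ⟨F.finite_toSet.subset hsub, ?_⟩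
      have hball : ∀ z : W, ((graphBall_finite G z L).toFinset).card ≤ (DG + 1) ^ L := fun z => by
        rw [← Set.ncard_eq_toFinset_card _ (graphBall_finite G z L)]
        exact ballVolume_le_pow_of_degree_le G hDG z L
      have hfib : ∀ w : W, ((hK w).1.toFinset).card ≤ K := fun w => by
        rw [← Set.ncard_eq_toFinset_card _ (hK w).1]; exact (hK w).2
      have hnb : ∀ x' : U, ((H.neighborFinset x').image fun y' => s(x', y')).card ≤ DH := fun x' =>
        Finset.card_image_le.trans (by rw [card_neighborFinset_eq_degree]; exact hDH x')
      calc (PathMapDom.over H P s(z₁, z₂)).ncard ≤ (↑F : Set (Sym2 U)).ncard := Set.ncard_le_ncard hsub F.finite_toSet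
        _ = F.card := Set.ncard_coe_finset F
        _ ≤ ∑ w ∈ (({z₁, z₂} : Finset W).biUnion fun z => (graphBall_finite G z L).toFinset),
              (((hK w).1.toFinset).biUnion fun x' => (H.neighborFinset x').image fun y' => s(x', y')).card := Finset.card_biUnion_le
        _ ≤ ∑ _w ∈ (({z₁, z₂} : Finset W).biUnion fun z => (graphBall_finite G z L).toFinset), K * DH := by
            refine Finset.sum_le_sum fun w _ => Finset.card_biUnion_le.trans ?_
            calc ∑ x' ∈ (hK w).1.toFinset, ((H.neighborFinset x').image fun y' => s(x', y')).card
                ≤ ∑ _x' ∈ (hK w).1.toFinset, DH := Finset.sum_le_sum fun x' _ => hnb x'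
              _ = ((hK w).1.toFinset).card * DH := by rw [Finset.sum_const, smul_eq_mul]
              _ ≤ K * DH := Nat.mul_le_mul_right DH (hfib w)
        _ = (({z₁, z₂} : Finset W).biUnion fun z => (graphBall_finite G z L).toFinset).card * (K * DH) := by
            rw [Finset.sum_const, smul_eq_mul]
        _ ≤ (2 * (DG + 1) ^ L) * (K * DH) := by
            refine Nat.mul_le_mul_right _ (Finset.card_biUnion_le.trans ?_)
            calc ∑ z ∈ ({z₁, z₂} : Finset W), ((graphBall_finite G z L).toFinset).card
                ≤ ∑ _z ∈ ({z₁, z₂} : Finset W), (DG + 1) ^ L := Finset.sum_le_sum fun z _ => hball z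
              _ = ({z₁, z₂} : Finset W).card * (DG + 1) ^ L := by rw [Finset.sum_const, smul_eq_mul]
              _ ≤ 2 * (DG + 1) ^ L := Nat.mul_le_mul_right _ Finset.card_le_two
        _ ≤ m := by rw [hm]; ring_nf; omega
  obtain ⟨slot, hslot⟩ := PathMapDom.exists_slot (H := H) (P := P) (m := m) (by rw [hm]; omega) hover
  exact PathMapDom.criticalProb_lt_one (G := G) (n := 2 * L + 1) (slot := slot) (by omega) hslot hconn hPE hPn (fun w => (hK w).1) x hpc

end GraphPathMap

end Summit.CriticalPhenomena.PercolationContinuityZ3.Theorems.Transplant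

end
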